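import Summits.Ventures.HSemireg.WedgeHankelSubstitutionSiegel
import Summits.Ventures.HSemireg.WedgeHankelSubstitutionTorelli

/-!
# Venture HSemireg — THE GENERAL LINEAR SUBSTITUTION (2f): THE PARABOLIC CASE — a shear has exactly ONE eigen-class (the point class of its fixed node `∞`, resp. `0`) as soon as
# `1, 2, …, n ≠ 0` in `K`; every eigenvalue on the class space is `1`; and a substitution with a fixed node `λ₁` is conjugate by `Φs λ₁` to a LOWER substitution

HONEST FRAMING. Part of the Lean index of the computation cell `pub-hsemireg` (seat p10 gen 19, Sunday typer «UNIFORM-IN-n»).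
Finite-dimensional EXTERIOR ALGEBRA over a field + th-7's sequence vocabulary ONLY: no variety, no cohomology theory, no sheaf, no Ext group, no semiregularity map;
nothing here says that HC / HC_CM / HC_AV holds; no Literature fact is declared or used.  Custodian versions as in `WedgeHankelSiegelIdeal` (1/3) and `WedgeHankelFrameChange`;
the dictionary (`Φs λ` = `exp(λΘ)·`, a translation `ν ↦ ν + λ` of the nodes with the single fixed node `∞`; a unipotent `(n+1) × (n+1)` Jordan block on `Sym^n`) is QUOTED, never asserted.

WHAT IS IN THE TREE.  E5 `Φs`, `Φs_w` (`w_n(q) ↦ w_n(expMul λ q)`), `expMul_eq_sum`; E7 `Ψs`, `Ψs_w` (`rev_n`); F1 `Ls = Ψs ∘ Φs ∘ Ψs`, `Ls_w`; H1 `Sb`, `Sb_comp`; H1b `w_eq_w_iff` (the class determines its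
window); F9 `coSiegel_n_eq_span_w`, `w_mem_coSiegel`, `finrank_coSiegel_n = n + 1`; C15 `w_add` / `w_smul` / `w_zero`.  I4/I6 (this seat) did the SEMISIMPLE case (two fixed nodes ⇒ an eigenbasis of
the class space).  THIS FILE does the PARABOLIC case (namespace `Summit.Ventures.HSemireg.Wedge.HankelFrameChange` continued):
* §182 `exists_eq_w_of_mem_coSiegel` (every element of the class space `coSiegel_n` IS a class `w_n(q)`: the span is already linear), `cast_succ_ne_zero_of_factorial` (`n! ≠ 0 ⇒ 1, …, n ≠ 0`).
* §183 **`expMul_window_eq_self_iff`**: for `λ ≠ 0` and `1, …, n ≠ 0` in `K`: `expMul λ q = q` on `[0, n]` IFF `q_0 = … = q_{n−1} = 0` (the triangular recursion: the coefficient of `q_i` in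
  `(expMul λ q)_{i+1}` is `(i+1)λ`); `expMul_window_eq_smul_iff_one` (an eigen-window has eigenvalue `1`: look at the lowest non-zero coefficient).
* §184 **`Φs_w_eq_self_iff`** (`Φs λ (w_n q) = w_n q ⇔ q_i = 0` for `i < n`), **`Φs_eigen_mem_span_point`: every eigenvector of `Φs λ` in the class space is a multiple of the POINT class
  `E_n = w_n(δ_n)` and its eigenvalue is `1`** — THE TRANSLATION `ν ↦ ν + λ` HAS EXACTLY ONE EIGEN-CLASS (so for `n ≥ 1` it is NOT diagonalizable on `coSiegel_n`: `finrank_span_point_lt`); the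
  mirror **`Ls_w_eq_self_iff`** / **`Ls_eigen_mem_span_pure_zero`** for F1's lower shear (fixed node `0`, eigen-class the pure class `E_0 = w_n(δ_0)`).
* §185 **`Sb_comp_frame_of_fixed_one`**: `β + λ₁δ = λ₁(α + λ₁γ)` ⇒ `Sb α β γ δ ∘ Sb 1 λ₁ 0 1 = Sb 1 λ₁ 0 1 ∘ Sb (α+λ₁γ) 0 γ (δ−λ₁γ)` — ANY substitution with a fixed node is conjugate by `Φs λ₁` to a
  LOWER one (I6's `…_infty` is `γ = 0`); `Sb_lower_parabolic_eq_comp` (`Sb a 0 c a = Sb a 0 0 a ∘ Sb 1 0 (c/a) 1`: the parabolic lower normal form is a homothety times `Ls (c/a)`), hence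
  **`Sb_parabolic_eigen_mem_span_pure`**: a substitution with a DOUBLE fixed node `λ₁` (`α + λ₁γ = δ − λ₁γ ≠ 0`, `γ ≠ 0`; `1, …, n ≠ 0` in `K`) has exactly one eigen-class in `coSiegel_n`,
  the PURE class `w_n(λ₁^•)` of its fixed node.
NOT typed here: the Jordan chain itself (`(Φs λ − 1)^n E_0 = n!·λ^n·E_n`); small characteristic (`p ≤ n`: extra fixed windows, e.g. `δ_{p−1}` in characteristic `p` when `p` is odd); fixed
nodes outside `K`; anything Ext-side.  Class side only; new names only.
-/

open Module

namespace Summit.Ventures.HSemireg.Wedge.HankelFrameChange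

open Summit.Ventures.HSemireg.Wedge Summit.Ventures.HSemireg.Wedge.Kunneth Summit.Ventures.HSemireg.Wedge.Hankel
  Summit.Ventures.HSemireg.Wedge.BasisFree Summit.Ventures.HSemireg.Wedge.HankelSiegel Summit.Ventures.HSemireg.Wedge.HankelSiegelIdeal
  Summit.Ventures.HSemireg.Wedge.KunnethKernel Summit.Ventures.HSemireg.Wedge.HankelRankOne Summit.Ventures.HSemireg.Wedge.KernelDuality

variable (K : Type*) [Field K] {n : ℕ}

/-! ## §182. Every element of the class space is a class -/

/-- **every element of `coSiegel_n` IS a class `w_n(q)`** (the classes form a linear family: F9's span is the range). -/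
theorem exists_eq_w_of_mem_coSiegel {f : HT K (In n)} (hf : f ∈ coSiegel K n n) : ∃ q : ℕ → K, f = w K n n q := by
  rw [coSiegel_n_eq_span_w] at hf
  induction hf using Submodule.span_induction with
  | mem x hx => obtain ⟨q, rfl⟩ := hx; exact ⟨q, rfl⟩
  | zero => exact ⟨fun _ => 0, (w_zero K n).symm⟩
  | add x y _ _ hx hy =>
    obtain ⟨q, rfl⟩ := hx; obtain ⟨q', rfl⟩ := hy
    exact ⟨fun j => q j + q' j, (w_add K n q q').symm⟩
  | smul c x _ hx =>
    obtain ⟨q, rfl⟩ := hx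
    exact ⟨fun j => c * q j, (w_smul K n c q).symm⟩

omit [Field K] in
/-- `n! ≠ 0` in a semiring ⇒ `1, 2, …, n ≠ 0` there. -/
lemma cast_succ_ne_zero_of_factorial {R : Type*} [CommSemiring R] (h : (n.factorial : R) ≠ 0) {i : ℕ} (hi : i < n) : ((i + 1 : ℕ) : R) ≠ 0 := by
  intro h0
  apply h
  obtain ⟨m, hm⟩ := Nat.dvd_factorial (Nat.succ_pos i) (Nat.succ_le_of_lt hi)
  rw [hm, Nat.cast_mul, h0, zero_mul]

/-! ## §183. The fixed windows of the binomial transform -/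

/-- if `q` vanishes below `n`, the binomial transform does not move its window: `expMul λ q = q` on `[0, n]` (no hypothesis on `λ`, `K`). -/
theorem expMul_window_eq_self_of_vanish (lam : K) {q : ℕ → K} (hq : ∀ i < n, q i = 0) {j : ℕ} (hj : j ≤ n) : expMul K lam q j = q j := by
  rw [expMul_eq_sum, Finset.sum_range_succ, Nat.choose_self, Nat.cast_one, one_mul, Nat.sub_self, pow_zero, one_mul, Finset.sum_eq_zero, zero_add]
  intro i hi
  rw [hq i (by have := Finset.mem_range.mp hi; omega), mul_zero]

/-- **THE FIXED WINDOWS: for `λ ≠ 0` and `1, …, n ≠ 0` in `K`, `expMul λ q = q` on `[0, n]` IFF `q_0 = … = q_{n−1} = 0`** — in `(expMul λ q)_{i+1} = q_{i+1} + (i+1)λ q_i + (lower `q`'s)` the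
lower terms vanish by induction and `(i+1)λ ≠ 0`. -/
theorem expMul_window_eq_self_iff {lam : K} (hlam : lam ≠ 0) (hn : ∀ i < n, ((i + 1 : ℕ) : K) ≠ 0) (q : ℕ → K) :
    (∀ j ≤ n, expMul K lam q j = q j) ↔ ∀ i < n, q i = 0 := by
  refine ⟨fun h => ?_, fun hq j hj => expMul_window_eq_self_of_vanish K lam hq hj⟩
  intro i
  induction i using Nat.strong_induction_on with
  | _ i ih =>
    intro hi
    have e := h (i + 1) (by omega)
    rw [expMul_eq_sum, Finset.sum_range_succ, Nat.choose_self, Nat.cast_one, Nat.sub_self, pow_zero, one_mul, one_mul] at e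
    -- the lower part of the sum vanishes by induction, the `t = i` term is `(i+1)·λ·q_i`
    have e' : ∑ t ∈ Finset.range (i + 1), ((i + 1).choose t : K) * lam ^ (i + 1 - t) * q t = 0 := add_right_cancel (e.trans (zero_add _).symm)
    rw [Finset.sum_range_succ, Nat.choose_succ_self_right, show i + 1 - i = 1 by omega, pow_one, Finset.sum_eq_zero, zero_add] at e'
    · exact (mul_eq_zero.mp e').resolve_left (mul_ne_zero (by exact_mod_cast hn i hi) hlam)
    · intro t ht
      rw [ih t (Finset.mem_range.mp ht) (by have := Finset.mem_range.mp ht; omega), mul_zero]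

/-- **AN EIGEN-WINDOW HAS EIGENVALUE `1`**: if `expMul λ q = c·q` on `[0, n]` and `q ≢ 0` there, then `c = 1` (the lowest non-zero coefficient is not moved; every `λ`, every `K`). -/
theorem expMul_window_eq_smul_iff_one (lam c : K) {q : ℕ → K} (hq : ∃ j ≤ n, q j ≠ 0) (h : ∀ j ≤ n, expMul K lam q j = c * q j) : c = 1 := by
  classical
  -- the lowest non-zero coefficient
  obtain ⟨j, hjn, hj⟩ := hq
  let P := Nat.find (⟨j, hjn, hj⟩ : ∃ j, j ≤ n ∧ q j ≠ 0)
  have hP : P ≤ n ∧ q P ≠ 0 := Nat.find_spec (⟨j, hjn, hj⟩ : ∃ j, j ≤ n ∧ q j ≠ 0)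
  have hlow : ∀ i < P, q i = 0 := fun i hi => by
    have := Nat.find_min (⟨j, hjn, hj⟩ : ∃ j, j ≤ n ∧ q j ≠ 0) hi
    push Not at this
    exact this (by omega)
  have e := h P hP.1
  rw [expMul_window_eq_self_of_vanish K lam (n := P) hlow le_rfl] at e
  exact (mul_left_eq_self₀.mp e.symm).resolve_right hP.2

/-! ## §184. The shear has exactly one eigen-class -/

/-- **`Φs λ (w_n q) = w_n q` IFF `q_i = 0` for `i < n`** (`λ ≠ 0`, `1, …, n ≠ 0` in `K`): the only fixed classes of the translation `ν ↦ ν + λ` are the multiples of the POINT class `E_n`. -/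
theorem Φs_w_eq_self_iff {lam : K} (hlam : lam ≠ 0) (hn : ∀ i < n, ((i + 1 : ℕ) : K) ≠ 0) (q : ℕ → K) :
    Φs K lam (w K n n q) = w K n n q ↔ ∀ i < n, q i = 0 := by
  rw [Φs_w K lam le_rfl, w_eq_w_iff, expMul_window_eq_self_iff K hlam hn]

/-- a window vanishing below `n` gives a multiple of the point class: `w_n(q) = q_n · E_n`. -/
theorem w_eq_smul_point_of_vanish {q : ℕ → K} (hq : ∀ i < n, q i = 0) : w K n n q = q n • w K n n (fun j => if j = n then (1 : K) else 0) := by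
  rw [← w_smul]
  refine w_eq_of_agree K n fun j hj => ?_
  by_cases h : j = n
  · rw [h, if_pos rfl, mul_one]
  · rw [if_neg h, mul_zero, hq j (by omega)]

/-- the point class is fixed by every shear (`y`-letters are fixed). -/
theorem Φs_w_point (lam : K) : Φs K lam (w K n n (fun j => if j = n then (1 : K) else 0)) = w K n n (fun j => if j = n then (1 : K) else 0) := by
  rw [Φs_w K lam le_rfl]
  exact w_eq_of_agree K n fun j hj => expMul_window_eq_self_of_vanish K lam (fun i hi => if_neg (by omega)) hj

/-- **EVERY EIGENVECTOR OF THE SHEAR IN THE CLASS SPACE IS A MULTIPLE OF THE POINT CLASS, WITH EIGENVALUE `1`**: `f ∈ coSiegel_n`, `f ≠ 0`, `Φs λ f = c·f` ⇒ `c = 1 ∧ f ∈ K∙E_n`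
(`λ ≠ 0`, `1, …, n ≠ 0` in `K`) — the translation has exactly ONE eigen-class; for `n ≥ 1` it is NOT diagonalizable on `coSiegel_n` (a unipotent Jordan block, dictionary quoted). -/
theorem Φs_eigen_mem_span_point {lam : K} (hlam : lam ≠ 0) (hn : ∀ i < n, ((i + 1 : ℕ) : K) ≠ 0) {f : HT K (In n)} (hf : f ∈ coSiegel K n n) (hf0 : f ≠ 0) {c : K}
    (h : Φs K lam f = c • f) : c = 1 ∧ f ∈ K ∙ w K n n (fun j => if j = n then (1 : K) else 0) := by
  obtain ⟨q, rfl⟩ := exists_eq_w_of_mem_coSiegel K hf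
  rw [Φs_w K lam le_rfl, ← w_smul, w_eq_w_iff] at h
  have hq : ∃ j ≤ n, q j ≠ 0 := by
    by_contra hno
    push Not at hno
    exact hf0 (by rw [w_eq_of_agree K n (q' := fun _ => (0 : K)) (fun i hi => hno i hi), w_zero])
  have hc : c = 1 := expMul_window_eq_smul_iff_one K lam c hq h
  refine ⟨hc, ?_⟩
  rw [hc] at h
  have hv : ∀ i < n, q i = 0 := (expMul_window_eq_self_iff K hlam hn q).mp fun j hj => by rw [h j hj, one_mul]
  rw [w_eq_smul_point_of_vanish K hv]
  exact Submodule.smul_mem _ _ (Submodule.mem_span_singleton_self _)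

/-- the eigen-line is one-dimensional while the class space has dimension `n + 1`: for `n ≥ 1` the shear's eigenvectors do not span `coSiegel_n`. -/
theorem finrank_span_point_lt (hn1 : 1 ≤ n) : finrank K (K ∙ w K n n (fun j => if j = n then (1 : K) else 0)) < finrank K (coSiegel K n n) := by
  rw [finrank_span_singleton (w_spike_ne_zero K le_rfl), finrank_coSiegel_n]
  omega

/-- the lower shear's window action, unfolded: `lowMul c q = d·q` on `[0,n]` iff `expMul c (rev_n q) = d·rev_n q` on `[0,n]` (`lowMul = rev ∘ expMul ∘ rev`). -/
lemma lowMul_window_iff (c d : K) (q : ℕ → K) :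
    (∀ j ≤ n, lowMul K n c q j = d * q j) ↔ ∀ i ≤ n, expMul K c (rev K n q) i = d * rev K n q i := by
  constructor
  · intro h i hi
    have e := h (n - i) (Nat.sub_le n i)
    unfold lowMul at e
    rw [rev_apply_of_le K (Nat.sub_le n i), Nat.sub_sub_self hi] at e
    rw [rev_apply_of_le K hi]
    exact e
  · intro h j hj
    have e := h (n - j) (Nat.sub_le n j)
    rw [rev_apply_of_le K (Nat.sub_le n j), Nat.sub_sub_self hj] at e
    unfold lowMul
    rw [rev_apply_of_le K hj]
    exact e

/-- **THE MIRROR: `Ls c (w_n q) = w_n q` IFF `q_i = 0` for `0 < i ≤ n`** (`c ≠ 0`, `1, …, n ≠ 0` in `K`): the lower shear `y ↦ y + cx` (fixed node `0`) fixes only the multiples of the pure class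
`E_0 = w_n(δ_0)`. -/
theorem Ls_w_eq_self_iff {c : K} (hc : c ≠ 0) (hn : ∀ i < n, ((i + 1 : ℕ) : K) ≠ 0) (q : ℕ → K) :
    Ls K (n := n) c (w K n n q) = w K n n q ↔ ∀ i, 0 < i → i ≤ n → q i = 0 := by
  rw [Ls_w, w_eq_w_iff]
  have h1 : (∀ j ≤ n, lowMul K n c q j = q j) ↔ ∀ j ≤ n, lowMul K n c q j = 1 * q j := by simp only [one_mul]
  have h2 : (∀ i ≤ n, expMul K c (rev K n q) i = 1 * rev K n q i) ↔ ∀ i ≤ n, expMul K c (rev K n q) i = rev K n q i := by simp only [one_mul]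
  rw [h1, lowMul_window_iff, h2, expMul_window_eq_self_iff K hc hn]
  constructor
  · intro h i hi hin
    have := h (n - i) (by omega)
    rwa [rev_apply_of_le K (Nat.sub_le n i), Nat.sub_sub_self hin] at this
  · intro h i hi
    rw [rev_apply_of_le K (le_of_lt hi)]
    exact h (n - i) (by omega) (Nat.sub_le n i)

/-- a window vanishing above `0` gives a multiple of the pure class at the node `0`: `w_n(q) = q_0 · E_0`. -/
theorem w_eq_smul_pure_zero_of_vanish {q : ℕ → K} (hq : ∀ i, 0 < i → i ≤ n → q i = 0) : w K n n q = q 0 • w K n n (fun j => if j = 0 then (1 : K) else 0) := by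
  rw [← w_smul]
  refine w_eq_of_agree K n fun j hj => ?_
  by_cases h : j = 0
  · rw [h, if_pos rfl, mul_one]
  · rw [if_neg h, mul_zero, hq j (Nat.pos_of_ne_zero h) hj]

/-- **EVERY EIGENVECTOR OF THE LOWER SHEAR IN THE CLASS SPACE IS A MULTIPLE OF THE PURE CLASS `E_0`, WITH EIGENVALUE `1`** (`c ≠ 0`, `1, …, n ≠ 0` in `K`). -/
theorem Ls_eigen_mem_span_pure_zero {c : K} (hc : c ≠ 0) (hn : ∀ i < n, ((i + 1 : ℕ) : K) ≠ 0) {f : HT K (In n)} (hf : f ∈ coSiegel K n n) (hf0 : f ≠ 0) {d : K}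
    (h : Ls K (n := n) c f = d • f) : d = 1 ∧ f ∈ K ∙ w K n n (fun j => if j = 0 then (1 : K) else 0) := by
  obtain ⟨q, rfl⟩ := exists_eq_w_of_mem_coSiegel K hf
  rw [Ls_w, ← w_smul, w_eq_w_iff, lowMul_window_iff] at h
  have hq : ∃ j ≤ n, rev K n q j ≠ 0 := by
    by_contra hno
    push Not at hno
    refine hf0 ?_
    rw [w_eq_of_agree K n (q' := fun _ => (0 : K)) (fun i hi => ?_), w_zero]
    have := hno (n - i) (Nat.sub_le n i)
    rwa [rev_apply_of_le K (Nat.sub_le n i), Nat.sub_sub_self hi] at this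
  have hd : d = 1 := expMul_window_eq_smul_iff_one K c d hq h
  refine ⟨hd, ?_⟩
  rw [hd] at h
  have hv : ∀ i, 0 < i → i ≤ n → q i = 0 := by
    have hv' : ∀ i < n, rev K n q i = 0 := (expMul_window_eq_self_iff K hc hn _).mp fun j hj => by rw [h j hj, one_mul]
    intro i hi hin
    have := hv' (n - i) (by omega)
    rwa [rev_apply_of_le K (Nat.sub_le n i), Nat.sub_sub_self hin] at this
  rw [w_eq_smul_pure_zero_of_vanish K hv]
  exact Submodule.smul_mem _ _ (Submodule.mem_span_singleton_self _)

/-! ## §185. A fixed node conjugates to a lower substitution; the parabolic normal form -/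

/-- **ANY SUBSTITUTION WITH A FIXED NODE `λ₁` IS CONJUGATE BY `Φs λ₁` TO A LOWER ONE: `β + λ₁δ = λ₁(α + λ₁γ) ⇒ Sb α β γ δ ∘ Sb 1 λ₁ 0 1 = Sb 1 λ₁ 0 1 ∘ Sb (α+λ₁γ) 0 γ (δ−λ₁γ)`**
(`Sb_comp` twice; I6's `Sb_comp_frame_of_fixed_infty` is `γ = 0`). -/
theorem Sb_comp_frame_of_fixed_one {α β γ δ l₁ : K} (e₁ : β + l₁ * δ = l₁ * (α + l₁ * γ)) :
    (Sb K α β γ δ).comp (Sb K (n := n) 1 l₁ 0 1) = (Sb K 1 l₁ 0 1).comp (Sb K (n := n) (α + l₁ * γ) 0 γ (δ - l₁ * γ)) := by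
  rw [Sb_comp, Sb_comp]
  congr 1
  · ring
  · linear_combination e₁
  · ring
  · ring

/-- applied form. -/
theorem Sb_Sb_frame_of_fixed_one {α β γ δ l₁ : K} (e₁ : β + l₁ * δ = l₁ * (α + l₁ * γ)) (f : HT K (In n)) :
    Sb K α β γ δ (Sb K 1 l₁ 0 1 f) = Sb K 1 l₁ 0 1 (Sb K (α + l₁ * γ) 0 γ (δ - l₁ * γ) f) := by
  rw [← AlgHom.comp_apply, Sb_comp_frame_of_fixed_one K e₁, AlgHom.comp_apply]

/-- **THE PARABOLIC LOWER NORMAL FORM: `Sb a 0 c a = Sb a 0 0 a ∘ Sb 1 0 (c/a) 1`** (`a ≠ 0`): a homothety times the lower shear `Ls (c/a)`. -/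
theorem Sb_lower_parabolic_eq_comp {a : K} (ha : a ≠ 0) (c : K) : Sb K (n := n) a 0 c a = (Sb K a 0 0 a).comp (Sb K (n := n) 1 0 (c / a) 1) := by
  rw [Sb_comp]
  congr 1
  · ring
  · ring
  · rw [one_mul, div_mul_cancel₀ c ha, add_zero]
  · ring

/-- `Φs λ₁ (E_0)` is the pure class of the node `λ₁`: `Φs λ₁ (w_n(δ_0)) = w_n(λ₁^•)`. -/
lemma Φs_w_spike_zero (l₁ : K) : Φs K l₁ (w K n n (fun j => if j = 0 then (1 : K) else 0)) = w K n n (fun j => l₁ ^ j) := by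
  rw [Φs_w K l₁ le_rfl]
  exact w_eq_of_agree K n fun j _ => by rw [expMul_spike_zero, one_mul]

/-- **A PARABOLIC SUBSTITUTION HAS EXACTLY ONE EIGEN-CLASS — THE PURE CLASS OF ITS FIXED NODE**: if `λ₁` is a DOUBLE fixed node of `[[α,β],[γ,δ]]` (`β + λ₁δ = λ₁(α+λ₁γ)`,
`δ − λ₁γ = α + λ₁γ ≠ 0`, `γ ≠ 0`) and `1, …, n ≠ 0` in `K`, then every eigenvector of `Sb α β γ δ` in the class space `coSiegel_n` is a multiple of `w_n(λ₁^•)`, with eigenvalue `(α+λ₁γ)^n`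
(conjugate by `Φs λ₁` to the lower normal form `a·Ls(γ/a)`, then §184). -/
theorem Sb_parabolic_eigen_mem_span_pure {α β γ δ l₁ : K} (e₁ : β + l₁ * δ = l₁ * (α + l₁ * γ)) (hpar : δ - l₁ * γ = α + l₁ * γ) (ha : α + l₁ * γ ≠ 0) (hγ : γ ≠ 0)
    (hn : ∀ i < n, ((i + 1 : ℕ) : K) ≠ 0) {f : HT K (In n)} (hf : f ∈ coSiegel K n n) (hf0 : f ≠ 0) {d : K} (h : Sb K α β γ δ f = d • f) :
    d = (α + l₁ * γ) ^ n ∧ f ∈ K ∙ w K n n (fun j => l₁ ^ j) := by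
  obtain ⟨q, rfl⟩ := exists_eq_w_of_mem_coSiegel K hf
  -- move the fixed node to `0`: `w_n q = Φs λ₁ (w_n q′)` with `q′ = expMul (−λ₁) q`
  have hf' : w K n n q = Φs K l₁ (w K n n (expMul K (-l₁) q)) := by
    rw [← Φs_w K (-l₁) le_rfl, Φs_Φs_eq_Sb, neg_add_cancel, Sb_one, AlgHom.id_apply]
  have hq'0 : w K n n (expMul K (-l₁) q) ≠ 0 := fun h0 => hf0 (by rw [hf', h0, map_zero])
  have hc : γ / (α + l₁ * γ) ≠ 0 := div_ne_zero hγ ha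
  -- in the new frame the substitution is the homothety `a` times the lower shear `Ls (γ/a)`
  have key : Sb K α β γ δ (w K n n q) = (α + l₁ * γ) ^ n • Φs K l₁ (Ls K (γ / (α + l₁ * γ)) (w K n n (expMul K (-l₁) q))) := by
    have e1 : Sb K α β γ δ (w K n n q) = Sb K 1 l₁ 0 1 (Sb K (α + l₁ * γ) 0 γ (α + l₁ * γ) (w K n n (expMul K (-l₁) q))) := by
      conv_lhs => rw [hf', ← AlgEquiv.coe_toAlgHom, Φs_eq_Sb, Sb_Sb_frame_of_fixed_one K e₁, hpar]
    have e2 : Sb K (α + l₁ * γ) 0 γ (α + l₁ * γ) (w K n n (expMul K (-l₁) q)) = (α + l₁ * γ) ^ n • Ls K (γ / (α + l₁ * γ)) (w K n n (expMul K (-l₁) q)) := by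
      rw [Sb_lower_parabolic_eq_comp K ha, AlgHom.comp_apply, ← Ls_eq_Sb, AlgEquiv.coe_toAlgHom, Ls_w, Sb_scalar_w K _ le_rfl]
    rw [e1, e2, map_smul, ← Φs_eq_Sb, AlgEquiv.coe_toAlgHom]
  -- compare with the eigen-equation and cancel `Φs λ₁`
  have h' : (α + l₁ * γ) ^ n • Ls K (γ / (α + l₁ * γ)) (w K n n (expMul K (-l₁) q)) = d • w K n n (expMul K (-l₁) q) :=
    (Φs K l₁).injective (by rw [map_smul, map_smul, ← hf', ← key]; exact h)
  have h'' : Ls K (γ / (α + l₁ * γ)) (w K n n (expMul K (-l₁) q)) = (((α + l₁ * γ) ^ n)⁻¹ * d) • w K n n (expMul K (-l₁) q) := by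
    rw [← smul_smul, ← h', smul_smul, inv_mul_cancel₀ (pow_ne_zero n ha), one_smul]
  obtain ⟨hd, hmem⟩ := Ls_eigen_mem_span_pure_zero K hc hn (w_mem_coSiegel K _) hq'0 h''
  refine ⟨?_, ?_⟩
  · have e := congrArg (fun t => (α + l₁ * γ) ^ n * t) hd
    simp only [← mul_assoc, mul_inv_cancel₀ (pow_ne_zero n ha), one_mul, mul_one] at e
    exact e
  · obtain ⟨t, ht⟩ := Submodule.mem_span_singleton.mp hmem
    rw [hf', ← ht, map_smul, Φs_w_spike_zero]
    exact Submodule.smul_mem _ _ (Submodule.mem_span_singleton_self _)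

end Summit.Ventures.HSemireg.Wedge.HankelFrameChange
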